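import Literature.AlgebraicGeometry.ModuliOfAbelianVarieties.SiegelCMLatticeReciprocityConverse
import Literature.NumberTheory.Adeles.IntegralAdelesIntegralBasis
import HarnessLib

/-!
# The rational lattice determines the adelic lattice, hypothesis-free: `q_v⁻¹Λ_a = ∏ 𝔞ᵢ ⇒ Θ_v⁻¹(a·ẑ^{2g}) = ∏ 𝔞̂ᵢ`
# ([Shimura 1998] §18.3; [Milne 2005] §4, Def. 12.8; [Cassels–Fröhlich] II §§10–14)

Topic `AlgebraicGeometry/ModuliOfAbelianVarieties`; namespace `Literature.AlgebraicGeometry.ModuliOfAbelianVarieties.CMStructure`.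
Cell hodgecm-mathlib (D-0151), #60 road (row I-7 `SiegelS1`; lead A-p05), leaf R60-35d: the named input `hbdd` of ★ R60-35b
`SiegelCMLatticeReciprocityConverse` DISCHARGED by ★ R60-35c `Adeles/IntegralAdelesIntegralBasis` (integral adèles have integral
coordinates), so that ★ R60-35 / ★ R60-35b / ★ R60-43 run from the RATIONAL lattice reading `q_v⁻¹(Λ_a) = ∏ 𝔞ᵢ` alone.  THEOREMS ONLY:
no definition, no named fact, no instance, no `sorry` (net Literature debt 0).  A banked GENERIC leaf (director s86 (2)(b)); HC_CM is
proved only modulo the printed citations until rung 0 closes.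

## What is proved (for `c : CMStructure g δ ι K`, `v ∈ ℚ^{2g}`)

* `exists_nat_mul_cmRepMatrix_mulVec_mem` — **the orbit map `Θ_v : u ↦ R(u)·(v ⊗ 1)` is BOUNDED on `∏ᵢ 𝓞̂ᵢ`**: there is `N ≥ 1` with
  `N · Θ_v(u) ∈ ẑ^{2g}` for all `u ∈ ∏ᵢ 𝓞̂ᵢ` (★ `cmRepMatrix` is `Σᵢ Σ_k coordᵢₖ(uᵢ) · act(bᵢₖ)`; the coordinates have bounded
  denominators by ★ `exists_nat_mul_repr_ratFiniteAdeleTensorEquiv_symm_mem`, the finitely many rational matrices `act(bᵢₖ)` and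
  the vector `v` have a common denominator).
* `forall_inv_mulVec_mem_iff_of_rational_reading` — ★ R60-35's adelic hypothesis `ha` from the rational reading `hrat` ALONE;
  `act_mem_latticeOfGL_mul_iff_of_rational_reading` (+ `…_of_coe_eq_cmRecipMatrix`) — «the lattice of `[J, r·a]` is `∏ tᵢ𝔞ᵢ`»,
  resp. `∏ N_{E,Φᵢ}(s)·𝔞ᵢ` at the reciprocity element of ★ `IsCanonical`, from `hrat` alone.

## References
* [Shimura1998] G. Shimura, *Abelian Varieties with Complex Multiplication and Modular Functions* (1998), §18.3 pp. 122–123.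
* [Milne2005ShimuraVarieties] J. S. Milne, *Introduction to Shimura varieties* (2005), §4 pp. 48–49; Def. 12.8 (60)–(62) p. 114.
* [CasselsFrohlichANT1967] J. W. S. Cassels, A. Fröhlich (eds.), *Algebraic Number Theory* (1967), Ch. II §§10–11, §14.
-/

set_option autoImplicit false

noncomputable section

open Module Function NumberField Matrix IsDedekindDomain
open scoped TensorProduct nonZeroDivisors

namespace Literature.AlgebraicGeometry.ModuliOfAbelianVarieties

namespace CMStructure

open Literature.AlgebraicGeometry.Motives (CMType)
open Literature.NumberTheory.ComplexMultiplication (traceField ratFiniteAdeleTensorEquiv reflexNormFiniteIdele)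
open Literature.NumberTheory.Automorphic (integralFiniteAdeles mem_integralFiniteAdeles_iff)
open Literature.NumberTheory.Adeles
  (latticeOfGL exists_nat_mul_repr_ratFiniteAdeleTensorEquiv_symm_mem algebraMap_intCast_mem_integralFiniteAdeles
    exists_nat_forall_mul_eq_intCast)
open Literature.NumberTheory.NumberFields.IdeleAction (idealAdeles ideleMulIdeal mem_idealAdeles_one_iff)

variable {g : ℕ} {δ : Fin g → ℕ} {ι : Type} [Fintype ι] [DecidableEq ι] {K : ι → Type} [∀ i, Field (K i)]
  [∀ i, NumberField (K i)] [∀ i, IsCMField (K i)] (c : CMStructure g δ ι K)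

/-! ### §1. `Θ_v` is bounded on integral adèles -/

/-- **The orbit map `Θ_v : u ↦ R(u)·(v ⊗ 1)` is bounded on `∏ᵢ 𝓞̂ᵢ`**: there is `N ≥ 1` with `N · (R(u)·(v ⊗ 1))_j ∈ ẑ` for every
`u ∈ ∏ᵢ 𝓞̂ᵢ` and every `j` — the hypothesis `hbdd` of ★ R60-35b.  Entrywise `R(u)·w = Σ_x Σᵢ Σ_k coordᵢₖ(uᵢ) · act(bᵢₖ)_{jx} · w_x`
with `coordᵢₖ(uᵢ) = adeleCoord` (denominators bounded by ★ `exists_nat_mul_repr_ratFiniteAdeleTensorEquiv_symm_mem`) and finitely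
many rationals `act(bᵢₖ)_{jx}`, `v_x`. [cite: CasselsFrohlichANT1967, Ch. II §11 and §14] [cite: Deligne1971TravauxShimura, 3.9 p. 140 and 4.18 p. 150] -/
theorem exists_nat_mul_cmRepMatrix_mulVec_mem (v : Fin g ⊕ Fin g → ℚ) :
    ∃ N : ℕ, N ≠ 0 ∧ ∀ u : Π i, FiniteAdeleRing (𝓞 (K i)) (K i),
      (∀ i, u i ∈ idealAdeles (1 : FractionalIdeal (𝓞 (K i))⁰ (K i))) →
        ∀ j, (N : finAdeleQ) * (c.cmRepMatrix u *ᵥ fun j => algebraMap ℚ finAdeleQ (v j)) j ∈ integralFiniteAdeles ℚ := by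
  classical
  -- per-factor denominators of the adelic coordinates
  have hD := fun i => exists_nat_mul_repr_ratFiniteAdeleTensorEquiv_symm_mem (K i) (Module.Free.chooseBasis ℚ (K i))
  choose d hd0 hd using hD
  -- denominators of the rational matrices `act(b_{ik})` and of `v`
  obtain ⟨Q₁, hQ₁0, hQ₁⟩ := exists_nat_forall_mul_eq_intCast
    (fun p : (Σ i, Module.Free.ChooseBasisIndex ℚ (K i)) × (Fin g ⊕ Fin g) × (Fin g ⊕ Fin g) =>
      c.actMatrix (Pi.single p.1.1 (Module.Free.chooseBasis ℚ (K p.1.1) p.1.2)) p.2.1 p.2.2)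
  obtain ⟨Q₂, hQ₂0, hQ₂⟩ := exists_nat_forall_mul_eq_intCast v
  refine ⟨(∏ i, d i) * Q₁ * Q₂, mul_ne_zero (mul_ne_zero (Finset.prod_ne_zero_iff.2 fun i _ => hd0 i) hQ₁0) hQ₂0,
    fun u hu j => ?_⟩
  have hu' : ∀ i (w : HeightOneSpectrum (𝓞 (K i))), u i w ∈ w.adicCompletionIntegers (K i) :=
    fun i => (mem_idealAdeles_one_iff).1 (hu i)
  -- unfold `R(u)·w` entrywise
  rw [Matrix.mulVec, dotProduct, Finset.mul_sum]
  refine sum_mem fun x _ => ?_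
  rw [cmRepMatrix, Matrix.sum_apply, Finset.sum_mul, Finset.mul_sum]
  refine sum_mem fun i _ => ?_
  rw [Matrix.sum_apply, Finset.sum_mul, Finset.mul_sum]
  refine sum_mem fun k _ => ?_
  rw [Matrix.smul_apply, Matrix.map_apply, smul_eq_mul]
  -- split the denominator
  obtain ⟨D', hD'⟩ : d i ∣ ∏ i, d i := Finset.dvd_prod_of_mem _ (Finset.mem_univ i)
  obtain ⟨m₁, hm₁⟩ := hQ₁ (⟨⟨i, k⟩, j, x⟩)
  obtain ⟨m₂, hm₂⟩ := hQ₂ x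
  have hsplit : (((∏ i, d i) * Q₁ * Q₂ : ℕ) : finAdeleQ) *
      (adeleCoord i (u i) k * algebraMap ℚ finAdeleQ (c.actMatrix (Pi.single i (Module.Free.chooseBasis ℚ (K i) k)) j x) *
        algebraMap ℚ finAdeleQ (v x)) =
      (D' : finAdeleQ) * ((d i : finAdeleQ) * adeleCoord i (u i) k) *
        (algebraMap ℚ finAdeleQ (m₁ : ℚ) * algebraMap ℚ finAdeleQ (m₂ : ℚ)) := by
    rw [← hm₁, ← hm₂, hD']
    simp only [Nat.cast_mul, map_mul, map_natCast]
    ring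
  rw [hsplit]
  refine mul_mem (mul_mem ?_ (hd i (u i) (hu' i) k)) (mul_mem (algebraMap_intCast_mem_integralFiniteAdeles m₁)
    (algebraMap_intCast_mem_integralFiniteAdeles m₂))
  exact_mod_cast algebraMap_intCast_mem_integralFiniteAdeles (D' : ℤ)


/-! ### §2. ★ R60-35 / R60-35b from the rational reading alone -/

/-- **`q_v⁻¹(Λ_a) = ∏ 𝔞ᵢ` RATIONALLY ⇒ `Θ_v⁻¹(a·ẑ^{2g}) = ∏ 𝔞̂ᵢ` ADELICALLY** (★ R60-35b `forall_inv_mulVec_mem_iff_of_rational` with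
its boundedness input discharged by §1): the hypothesis `ha` of ★ R60-35 holds as soon as `act(x)·v ∈ Λ_a ↔ xᵢ ∈ 𝔞ᵢ` for `x ∈ F`.
[cite: Shimura1998, §18.3 pp. 122–123] [cite: Milne2005ShimuraVarieties, §4 pp. 48–49] [cite: CasselsFrohlichANT1967, Ch. II §14–§15] -/
theorem forall_inv_mulVec_mem_iff_of_rational_reading {v : Fin g ⊕ Fin g → ℚ} {a : GL (Fin g ⊕ Fin g) finAdeleQ}
    {𝔞 : Π i, FractionalIdeal (𝓞 (K i))⁰ (K i)} (h𝔞 : ∀ i, 𝔞 i ≠ 0)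
    (hrat : ∀ x : Π i, K i, c.act x v ∈ latticeOfGL a ↔ ∀ i, x i ∈ 𝔞 i)
    (u : Π i, FiniteAdeleRing (𝓞 (K i)) (K i)) :
    (∀ j, (((a⁻¹ : GL (Fin g ⊕ Fin g) finAdeleQ) : Matrix (Fin g ⊕ Fin g) (Fin g ⊕ Fin g) finAdeleQ) *ᵥ
          (c.cmRepMatrix u *ᵥ fun j => algebraMap ℚ finAdeleQ (v j))) j ∈ integralFiniteAdeles ℚ) ↔
      ∀ i, u i ∈ idealAdeles (𝔞 i) :=
  c.forall_inv_mulVec_mem_iff_of_rational h𝔞 hrat (c.exists_nat_mul_cmRepMatrix_mulVec_mem v) u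

/-- **THE LATTICE OF `[J, r·a]` FROM THE RATIONAL READING OF `[J, a]`**: if `q_v⁻¹(Λ_a) = ∏ 𝔞ᵢ` and `(r : matrix) = R(t)` then
`act(x)·v ∈ Λ_{r·a} ↔ xᵢ ∈ tᵢ𝔞ᵢ` (★ R60-35 `act_mem_latticeOfGL_mul_iff`, hypothesis-free in `ha`).
[cite: Shimura1998, §18.3 pp. 122–123] [cite: Milne2005ShimuraVarieties, Def. 12.8 (60)–(62) p. 114] -/
theorem act_mem_latticeOfGL_mul_iff_of_rational_reading {v : Fin g ⊕ Fin g → ℚ} {a r : GL (Fin g ⊕ Fin g) finAdeleQ}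
    {t : Π i, (FiniteAdeleRing (𝓞 (K i)) (K i))ˣ}
    (hr : ((r : GL (Fin g ⊕ Fin g) finAdeleQ) : Matrix (Fin g ⊕ Fin g) (Fin g ⊕ Fin g) finAdeleQ) =
      c.cmRepMatrix fun i => (t i : FiniteAdeleRing (𝓞 (K i)) (K i)))
    {𝔞 : Π i, FractionalIdeal (𝓞 (K i))⁰ (K i)} (h𝔞 : ∀ i, 𝔞 i ≠ 0)
    (hrat : ∀ x : Π i, K i, c.act x v ∈ latticeOfGL a ↔ ∀ i, x i ∈ 𝔞 i) (x : Π i, K i) :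
    c.act x v ∈ latticeOfGL (r * a) ↔ ∀ i, x i ∈ ideleMulIdeal (t i) (𝔞 i) :=
  c.act_mem_latticeOfGL_mul_iff_of_rational hr h𝔞 hrat (c.exists_nat_mul_cmRepMatrix_mulVec_mem v) x

/-- The same at the reciprocity element `r(s)` of ★ `SiegelRationalModel.IsCanonical` (`(r : matrix) = c.cmRecipMatrix Φ E s`): from the
rational reading of `[J, a]`, the lattice of `[J, r(s)·a]` is `∏ N_{E,Φᵢ}(s)·𝔞ᵢ` — Milne's (60)–(62) «`σ[x, a] = [x, r_x(s)·a]`» on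
lattices, unconditionally. [cite: Milne2005ShimuraVarieties, Thm. 11.2 p. 108; Def. 12.8 (60)–(62) p. 114] [cite: Shimura1998, §18.3 pp. 122–123] -/
theorem act_mem_latticeOfGL_mul_iff_of_rational_reading_of_coe_eq_cmRecipMatrix {v : Fin g ⊕ Fin g → ℚ}
    {a r : GL (Fin g ⊕ Fin g) finAdeleQ} (Φ : ∀ i, CMType (K i)) (E : IntermediateField ℚ ℂ) [NumberField ↥E]
    (s : (FiniteAdeleRing (𝓞 ↥E) ↥E)ˣ)
    (hr : ((r : GL (Fin g ⊕ Fin g) finAdeleQ) : Matrix (Fin g ⊕ Fin g) (Fin g ⊕ Fin g) finAdeleQ) = c.cmRecipMatrix Φ E s)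
    {𝔞 : Π i, FractionalIdeal (𝓞 (K i))⁰ (K i)} (h𝔞 : ∀ i, 𝔞 i ≠ 0)
    (hrat : ∀ x : Π i, K i, c.act x v ∈ latticeOfGL a ↔ ∀ i, x i ∈ 𝔞 i) (x : Π i, K i) :
    c.act x v ∈ latticeOfGL (r * a) ↔ ∀ i, x i ∈ ideleMulIdeal (reflexNormFiniteIdele (K i) (Φ i) E s) (𝔞 i) :=
  c.act_mem_latticeOfGL_mul_iff_of_rational_reading (t := fun i => reflexNormFiniteIdele (K i) (Φ i) E s) hr h𝔞 hrat x

end CMStructure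

end Literature.AlgebraicGeometry.ModuliOfAbelianVarieties

end
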